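import Summits.ValiantsHypothesis.ValiantsHypothesis.Theorems.LacunarySymmetroidMatrixDescartesCensusDoorA34NineInertiaChamberIIUnique

/-!
# `MatrixDescartes` census — DOOR A at `(3,4)`: the CHAMBER-II uniqueness law for an ARBITRARY positive definite bottom letter (congruence)

HONEST FRAMING.  Object-search cell `pub-symmetroid`, door-A seat `val-sym-door-p3` (g16); helper file beside the OPEN typed statement
`DoorA34 = PosRootLawAt 3 4 18` (route item `Theses.LacunarySymmetroid.DoorA34`, stmt-ValiantsHypothesis-19980), asserted nowhere here.
`…ChamberIIUnique` proves: a chamber-II nine-row with bottom letter `1` has at most one positive-semidefinite singular point.  Here the bottom letter is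
any `S₀ ≻ 0`: write `S₀ = YᵀY` (`exists_transpose_mul_self_of_posDef`, spectral theorem), pass to the congruent pencil `Y⁻ᵀ F(x) Y⁻¹` with bottom letter
`1` (same det-roots: `card_posRoots_congr`; PSD-singular points correspond), and conclude **`chamberII_unique_psdSingular_of_posDef`**: for real
symmetric `S₀ ≻ 0, S₁, S₂` and `2d₁ < d₂ < 3d₁` (`d₀ = 0`), a nine-row `F = S₀ + X^{d₁}S₁ + X^{d₂}S₂` has at most ONE `x > 0` with `F(x)` positive
semidefinite and singular.  This is the form the flag ladder meets (`Census.FlagInertia`: the source's exponent-0 letter is definite and its walk is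
pure-λ_min).  Nothing here bounds `ζ_sym(3,3)` or `ζ_sym(3,4)`; `DoorA34`, Claim L on `d₂ < 2d₁` and `MatrixDescartes` (stmt-ValiantsHypothesis-18050) stay
OPEN; nothing on `VP ≠ VNP`.
[folklore] Spectral theorem; congruence; elementary.
-/

open Finset Matrix Polynomial

-- `Summit.ValiantsHypothesis.ValiantsHypothesis.…` repeats a component by the D-0017 layout
-- (single-conjunct summit), which the `dupNamespace` linter flags; the name is mandated.
set_option linter.dupNamespace false

namespace Summit.ValiantsHypothesis.ValiantsHypothesis.Theorems.LacunarySymmetroidMatrixDescartes.Census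

namespace NineInertia

open scoped BigOperators Matrix Polynomial

/-- **Gram factor of a positive definite real matrix**: `A ≻ 0 ⇒ A = YᵀY` with `det Y ≠ 0` (spectral theorem, `Y = √D·Uᵀ`). [folklore] -/
theorem exists_transpose_mul_self_of_posDef {n : Type*} [Fintype n] [DecidableEq n] {A : Matrix n n ℝ} (hA : A.PosDef) :
    ∃ Y : Matrix n n ℝ, Y.det ≠ 0 ∧ A = Yᵀ * Y := by
  set U : Matrix n n ℝ := (hA.1.eigenvectorUnitary : Matrix n n ℝ) with hUdef
  set lam : n → ℝ := hA.1.eigenvalues with hlam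
  have hlam_pos : ∀ i, 0 < lam i := fun i => hA.eigenvalues_pos i
  have hAeq : A = U * diagonal lam * star U := by simpa [Unitary.conjStarAlgAut_apply, hUdef, hlam] using hA.1.spectral_theorem
  have hUU : star U * U = 1 := Unitary.coe_star_mul_self _
  set E : Matrix n n ℝ := diagonal (fun i => Real.sqrt (lam i)) with hEdef
  have hEE : E * E = diagonal lam := by
    rw [hEdef, diagonal_mul_diagonal]; congr 1; funext i; exact Real.mul_self_sqrt (hlam_pos i).le
  have hEstar : star E = E := by rw [star_eq_conjTranspose, hEdef, diagonal_conjTranspose]; congr 1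
  set Y : Matrix n n ℝ := E * star U with hYdef
  have hY : A = star Y * Y := by
    rw [hYdef, star_mul, star_star, hEstar, hAeq, ← hEE]
    simp only [Matrix.mul_assoc]
  have hEdet : E.det ≠ 0 := by
    rw [hEdef, det_diagonal]; exact Finset.prod_ne_zero_iff.mpr fun i _ => (Real.sqrt_pos.mpr (hlam_pos i)).ne'
  have hUdet : (star U).det ≠ 0 := fun h0 => by
    have := congrArg Matrix.det hUU
    rw [det_mul, h0, zero_mul, det_one] at this; exact zero_ne_one this
  have hYdet : Y.det ≠ 0 := by rw [hYdef, det_mul]; exact mul_ne_zero hEdet hUdet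
  refine ⟨Y, hYdet, ?_⟩
  rw [hY, star_eq_conjTranspose, conjTranspose_eq_transpose_of_trivial]

/-- Congruence of a lacunary pencil: `∑ X^{d l} • (P S_l Q) = P · (∑ X^{d l} • S_l) · Q` after `map C` (any sizes of the letter family). [folklore] -/
theorem pencil_congr (d : Fin 3 → ℕ) (S : Fin 3 → Matrix (Fin 3) (Fin 3) ℝ) (P Q : Matrix (Fin 3) (Fin 3) ℝ) :
    (∑ l, ((X : ℝ[X]) ^ d l) • (P * S l * Q).map C) = P.map C * (∑ l, ((X : ℝ[X]) ^ d l) • (S l).map C) * Q.map C := by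
  rw [Finset.mul_sum, Finset.sum_mul]
  refine Finset.sum_congr rfl fun l _ => ?_
  rw [Matrix.map_mul, Matrix.map_mul, Matrix.mul_smul, Matrix.smul_mul]

/-- Congruent pencils have the same number of distinct positive det-roots (`det P, det Q ≠ 0`). [folklore] -/
theorem card_posRoots_congr (d : Fin 3 → ℕ) (S : Fin 3 → Matrix (Fin 3) (Fin 3) ℝ) (P Q : Matrix (Fin 3) (Fin 3) ℝ)
    (hP : P.det ≠ 0) (hQ : Q.det ≠ 0) :
    ((Matrix.det (∑ l, ((X : ℝ[X]) ^ d l) • (P * S l * Q).map C)).roots.toFinset.filter (fun t => 0 < t)).card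
      = ((Matrix.det (∑ l, ((X : ℝ[X]) ^ d l) • (S l).map C)).roots.toFinset.filter (fun t => 0 < t)).card := by
  have hPC : (P.map C).det = C P.det := by rw [← RingHom.mapMatrix_apply, ← RingHom.map_det]
  have hQC : (Q.map C).det = C Q.det := by rw [← RingHom.mapMatrix_apply, ← RingHom.map_det]
  have hdet : (Matrix.det (∑ l, ((X : ℝ[X]) ^ d l) • (P * S l * Q).map C))
      = C (P.det * Q.det) * Matrix.det (∑ l, ((X : ℝ[X]) ^ d l) • (S l).map C) := by
    rw [pencil_congr, Matrix.det_mul, Matrix.det_mul, hPC, hQC, map_mul]; ring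
  rw [hdet, Polynomial.roots_C_mul _ (mul_ne_zero hP hQ)]

/-- Evaluation form of the congruence: `∑ x^{d l} • (P S_l Q) = P (∑ x^{d l} • S_l) Q`. [folklore] -/
theorem eval_pencil_congr (d : Fin 3 → ℕ) (S : Fin 3 → Matrix (Fin 3) (Fin 3) ℝ) (P Q : Matrix (Fin 3) (Fin 3) ℝ) (x : ℝ) :
    (∑ l, x ^ d l • (P * S l * Q)) = P * (∑ l, x ^ d l • S l) * Q := by
  rw [Finset.mul_sum, Finset.sum_mul]
  refine Finset.sum_congr rfl fun l _ => ?_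
  rw [Matrix.mul_smul, Matrix.smul_mul]

/-- **CHAMBER-II NINE-ROWS WITH A POSITIVE DEFINITE BOTTOM LETTER HAVE AT MOST ONE PSD-SINGULAR POINT.**  `F = S₀ + X^{d₁}S₁ + X^{d₂}S₂` with real
symmetric letters, `S₀ ≻ 0`, `d₀ = 0`, `2d₁ < d₂ < 3d₁`, NINE distinct positive det-roots: if `F(x₁)`, `F(x₂)` are positive semidefinite and singular
with `0 < x₁ ≤ x₂` then `x₁ = x₂`.  (Congruence to bottom letter `1` + `chamberII_unique_psdSingular`.)  So the flag ladder — whose source must be a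
definite-bottom nine-row all of whose nine roots are PSD-singular (`Census.FlagInertia`) — has no source on any chamber-II support. [folklore] -/
theorem chamberII_unique_psdSingular_of_posDef (d : Fin 3 → ℕ) (S : Fin 3 → Matrix (Fin 3) (Fin 3) ℝ) (hS : ∀ l, (S l).IsSymm)
    (hP0 : (S 0).PosDef)
    (h9 : 9 ≤ ((Matrix.det (∑ l, ((X : ℝ[X]) ^ d l) • (S l).map C)).roots.toFinset.filter (fun t => 0 < t)).card)
    (h0 : d 0 = 0) (hIIa : 2 * d 1 < d 2) (hIIb : d 2 < 3 * d 1)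
    {x₁ x₂ : ℝ} (hx₁ : 0 < x₁) (hle : x₁ ≤ x₂)
    (hpsd₁ : (∑ l, x₁ ^ d l • S l).PosSemidef) {k₁ : Fin 3 → ℝ} (hk₁ : k₁ ≠ 0) (hker₁ : (∑ l, x₁ ^ d l • S l) *ᵥ k₁ = 0)
    (hpsd₂ : (∑ l, x₂ ^ d l • S l).PosSemidef) {k₂ : Fin 3 → ℝ} (hk₂ : k₂ ≠ 0) (hker₂ : (∑ l, x₂ ^ d l • S l) *ᵥ k₂ = 0) :
    x₁ = x₂ := by
  obtain ⟨Y, hYdet, hY⟩ := exists_transpose_mul_self_of_posDef hP0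
  have hYu : IsUnit Y.det := isUnit_iff_ne_zero.mpr hYdet
  set Z : Matrix (Fin 3) (Fin 3) ℝ := Y⁻¹ with hZ
  have hYZ : Y * Z = 1 := Matrix.mul_nonsing_inv Y hYu
  have hZY : Z * Y = 1 := Matrix.nonsing_inv_mul Y hYu
  have hZdet : Z.det ≠ 0 := by
    intro h; have := congrArg Matrix.det hYZ; rw [det_mul, h, mul_zero, det_one] at this; exact zero_ne_one this
  have hZtdet : Zᵀ.det ≠ 0 := by rwa [det_transpose]
  -- the congruent letters with bottom letter 1
  set S' : Fin 3 → Matrix (Fin 3) (Fin 3) ℝ := fun l => Zᵀ * S l * Z with hS'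
  have hS'0 : S' 0 = 1 := by
    show Zᵀ * S 0 * Z = 1
    rw [hY, ← Matrix.mul_assoc, ← transpose_mul, Matrix.mul_assoc, hYZ, transpose_one, Matrix.one_mul]
  have hS'symm : ∀ l, (S' l).IsSymm := fun l => by
    show (Zᵀ * S l * Z).IsSymm
    unfold Matrix.IsSymm
    rw [transpose_mul, transpose_mul, transpose_transpose, (hS l).eq, Matrix.mul_assoc]
  have h9' : 9 ≤ ((Matrix.det (∑ l, ((X : ℝ[X]) ^ d l) • (S' l).map C)).roots.toFinset.filter (fun t => 0 < t)).card := by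
    show 9 ≤ ((Matrix.det (∑ l, ((X : ℝ[X]) ^ d l) • (Zᵀ * S l * Z).map C)).roots.toFinset.filter (fun t => 0 < t)).card
    rw [card_posRoots_congr d S Zᵀ Z hZtdet hZdet]; exact h9
  -- PSD-singular points transfer
  have psd' : ∀ {x : ℝ} {k : Fin 3 → ℝ}, (∑ l, x ^ d l • S l).PosSemidef → k ≠ 0 → (∑ l, x ^ d l • S l) *ᵥ k = 0 →
      (∑ l, x ^ d l • S' l).PosSemidef ∧ Y *ᵥ k ≠ 0 ∧ (∑ l, x ^ d l • S' l) *ᵥ (Y *ᵥ k) = 0 := by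
    intro x k hpsd hk hker
    have hcongr : (∑ l, x ^ d l • S' l) = Zᵀ * (∑ l, x ^ d l • S l) * Z := eval_pencil_congr d S Zᵀ Z x
    refine ⟨?_, ?_, ?_⟩
    · rw [hcongr, ← conjTranspose_eq_transpose_of_trivial]
      exact hpsd.conjTranspose_mul_mul_same Z
    · intro h
      apply hk
      have := congrArg (fun v => Z *ᵥ v) h
      simpa [Matrix.mulVec_mulVec, hZY] using this
    · rw [hcongr, ← Matrix.mulVec_mulVec, ← Matrix.mulVec_mulVec, Matrix.mulVec_mulVec k Z Y, hZY, Matrix.one_mulVec, hker,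
        Matrix.mulVec_zero]
  obtain ⟨p1, n1, k1⟩ := psd' hpsd₁ hk₁ hker₁
  obtain ⟨p2, n2, k2⟩ := psd' hpsd₂ hk₂ hker₂
  exact chamberII_unique_psdSingular d S' hS'symm h9' h0 hS'0 hIIa hIIb hx₁ hle p1 n1 k1 p2 n2 k2

end NineInertia

end Summit.ValiantsHypothesis.ValiantsHypothesis.Theorems.LacunarySymmetroidMatrixDescartes.Census
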